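import Mathlib.AlgebraicGeometry.Morphisms.Smooth
import Mathlib.AlgebraicGeometry.IdealSheaf.Subscheme
import Mathlib.Analysis.Normed.Field.Basic
import Mathlib.Topology.MetricSpace.Basic
import Literature.AlgebraicGeometry.Motives.SecOfForm
import Literature.AlgebraicGeometry.Resolution.GenericForms
import Literature.AlgebraicGeometry.HodgeTheory.AlgebraicClasses
import HarnessLib

/-!
# Singularities of the admissible normal function of a primitive Hodge class (Green–Griffiths, BFNP, de Cataldo–Migliorini, Kerr–Pearlstein)

Family `hodge`, layer `Literature/AlgebraicGeometry/HodgeTheory`. Definition request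
`AdmissibleNormalFunctionSingularity` (route HeightMassDefect of the Hodge conjecture: items
`SingularityForcesSectionRestriction`, `MassDefectDetectsSingularity`, `HeightPackage`).

**Setting** (KP = Kerr–Pearlstein 2011 §3.3; BFNP = Brosnan–Fang–Nie–Pearlstein 2009 Para 37; dCM =
de Cataldo–Migliorini 2009 §2.1). `X ⊂ ℙⁿ` smooth projective of dimension `2m` over `ℂ` (tree:
`X : Motives.SchemeOver ℂ`, `e : Motives.ProjectiveEmbedding X`, `L = e^*𝒪(1)` very ample), `k ≥ 1`,
`P̄ = |L^{⊗k}|`, `π : 𝒳 = {(x, s) ∈ X × P̄ | s(x) = 0} → P̄` the incidence variety (KP (3-6)) with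
fibres the hypersurface sections `X_s`, `X̂ ⊂ P̄` the dual variety (`X_s` singular), `U = P̄ ∖ X̂`,
`ℋ` the variation of Hodge structure of weight `-1` on `U` on `R^{2m-1}π^{sm}_*ℤ(m)`. A Hodge class
`ζ ∈ H^{m,m}(X, ℤ(m))` is *primitive* if `ζ|_{X_s} = 0` for all `s ∈ U` (for this family = the usual
`ζ ∪ c₁(L) = 0`, KP p. 322; BFNP Para 33). It has an **admissible normal function**
`ν_ζ = AJ(ζ) ∈ ANF(U, ℋ)/Jᵐ(X)` (KP (3-4)–(3-5): restrictions of a Deligne lift of `ζ`, admissible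
by M. Saito), and at each `p ∈ P̄` a **singularity** `sing_p(ν_ζ) ∈ (R¹j_*ℋ_ℚ)_p =
colim_{B ∋ p} H¹(B ∩ U, ℋ_ℚ)`, the germ at `p` of the class `cl(ν_ζ) ∈ H¹(U, ℋ)` of the extension of
local systems underlying `ν_ζ` (KP p. 321; BFNP (1.1), Para 8), independent of the lift (KP
Lemma 40), lying in `IH¹_p(ℋ_ℚ) ↪ (R¹j_*ℋ_ℚ)_p` (BFNP Lemma 5, Thm. 12, Rem. 27). **`ν_ζ` is singular
at `p`** if `sing_p(ν_ζ) ≠ 0`; *singular on `P̄`* if so at some `p ∈ X̂` (KP Def. 38 and after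
Lemma 40; BFNP §1). KP Conj. 41 = BFNP Conj. 1 (Green–Griffiths): `ζ ≠ 0 ⟹ ν_ζ` singular on
`|L^{⊗k}|` for some `k`; KP Thm. 42 = BFNP Thm. 2: this for all even-dimensional `X` ⟺ Hodge conjecture.

## What is defined (REAL definitions only; the theorems about them are named facts in `NormalFunctionSingularityFacts`)

* `CoeffSpace n k = (Resolution.Monomials (Fin (n+1)) k → ℂ)` — coefficient vectors `a = (a_m)_{|m|=k}`
  of degree-`k` forms on `ℙⁿ` (topology of `ℂ^M`): the affine cone over `|𝒪_{ℙⁿ}(k)|`, see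
  "Rendering" 3. The forms themselves are the tree's `Resolution.formOfCoeffs a = Σ a_m x^m`
  (`Literature/AlgebraicGeometry/Resolution/GenericForms`: `isHomogeneous_formOfCoeffs`,
  `formOfCoeffs_coeff` = every form of degree `k` arises); here only `formOfCoeffs_zero` is added.
* `memberSet e F ⊆ X` — scheme points of the section `X_F = X ∩ V₊(F)` (`e⁻¹ V₊(F)`, the spelling of
  route `HeightMassDefect.SectionRestriction`); `MemberPoints e F = X_F(ℂ)` (analytic topology);
  `restrictToMember e F d : Hᵈ(X(ℂ); ℂ) ⟶ Hᵈ(X_F(ℂ); ℂ)` = the restriction `α_p` of KP (3-7).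
* `memberIdeal e F hF` — `X_F` as a closed subSCHEME of `X`: zero scheme of the section `F(s₀,…,sₙ)` of
  `L^{⊗k}` (tree `Motives.GeneratingSections.Sec.zeroIdeal`/`secOfForm`; Görtz–Wedhorn (13.13));
  `smoothLocus e k` — the cone over `U`: `F_a ∉ I(X)` and `X_{F_a} → Spec ℂ` smooth (Mathlib
  `AlgebraicGeometry.Smooth`); `dualVarietyCone e k` — the cone over `X̂`.
* `familyOver e k S = 𝒳_S = {(P, a) ∈ X(ℂ) × CoeffSpace | a ∈ S, P ∈ X_{F_a}}` (KP (3-6), subspace of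
  the product) and `familyClassMap e k S d = pr₁^* : Hᵈ(X(ℂ); ℂ) ⟶ Hᵈ(𝒳_S; ℂ)`.
* `IsPrimitiveFor e k ζ` — `ζ|_{X_F} = 0` for all smooth members (KP p. 322; BFNP Para 33).
* `AdmissibleNormalFunctionSingularity e k ζ a` — **`ν_{ζ,k}` is singular at `[F_a]`**, rendered as:
  for every neighbourhood `B` of `a`, `pr₁^*ζ ≠ 0` on `𝒳_{B ∩ U}` (the incidence variety over the SMOOTH
  members in `B`). API: balls suffice (`…_iff_ball`), shrinking (`…_of_forall_exists`), and `sing_p` is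
  a homomorphism: `.not_zero`, `.ne_zero`, `.add`, `.smul_iff`, `.neg_iff` (KP after Lemma 40).
* `IsSingularOn e k ζ` — singular at some point of the dual variety cone (KP Def. 38): the predicate
  of KP Conjecture 41.

## Rendering and faithfulness (the identification the reviewer must accept)

The tree has no VMHS, intermediate Jacobians, Deligne cohomology or perverse sheaves, so `ν_ζ` is not
constructed; the consumers use only the predicate `sing_p(ν_ζ) ≠ 0`, which is TOPOLOGICAL:
1. (dCM Def. 3.3, "an essentially elementary definition") For primitive `ζ ∈ H^{2m}(X)` the *local
   Green–Griffiths invariant* is `s(ζ)_p := [ζ|_{X_p}]₀₀ ∈ H^{-d+1}(IC(R^{2m-1}))_p = IH¹_p(ℋ)`, the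
   component of `ζ|_{X_p}` in the decomposition `Rπ_*ℚ ≅ ⊕ IC(L_{ij})[…]` (dCM (4), (8), (12));
   and `sing_p(ν_ζ) ⊗ ℚ = s(ζ)_p`: BFNP Para 33–36, Prop. 35 (`σ_p : H^{2m}(𝒳) →Π IH¹_p`, factoring
   through Hodge classes, computes `sing_p` of the normal function of any Deligne/absolute-Hodge lift),
   KP (3-11)–(3-12), Remark 55 (passing to `ℋ^{van}` only kills `Jᵐ(X)`); dCM p. 2: BFNP's notion
   "essentially coincides with ours".
2. `s(ζ)_p ≠ 0 ⟺ (∀ B ∋ p neighbourhood: ζ|_{𝒳_{B∩U}} ≠ 0 in H^{2m}(𝒳_{B∩U}))` — the definition here.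
   By dCM Lemma 3.1 (ii) and (16)–(18), `ζ|_{X_p} = [ζ|_{X_p}]₀₀ + [ζ|_{X_p}]₀₁` plus components of
   perverse degree `i ≤ -1`, which lie in `H^{1-i}` of CONSTANT sheaves `E_{i0} = H^{2m-1+i}(X) ⊗ ℚ_{P̄}`
   (BFNP Thm. 38 (ii), perverse weak Lefschetz = KP Thm. 53; Cor. 40) and so vanish on balls; the
   degree-`1` piece is `0` by primitivity (dCM Lemma 3.1 (ii); KP p. 330). For a small ball `B`,
   `H(𝒳_B) ≃ H(X_p)` compatibly (dCM (13)); restricting to `B ∩ U`, `[·]₀₁ ∈ H^{-d+1}(IC(L₀₁))_p` dies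
   (`L₀₁` lives on `X̂`), and `[·]₀₀` maps into the summand `H¹(B ∩ U, R^{2m-1})` of
   `H^{2m}(𝒳_{B∩U}) = ⊕_i H^{1-i}(B ∩ U, R^{2m-1+i})` (decomposition restricted to `U`, dCM (5)), which
   in the colimit over `B` is the INJECTION `IH¹_p(ℋ) ↪ H¹_p(ℋ) = colim_B H¹(B ∩ U, ℋ)` (BFNP Lemma 5).
   So `s(ζ)_p ≠ 0` forces `ζ|_{𝒳_{B∩U}} ≠ 0` for every `B`, and `s(ζ)_p = 0` forces `= 0` for small `B`.
   (`ℂ`- instead of `ℚ`-coefficients: `⊗_ℚ ℂ` is faithfully flat, non-vanishing is unchanged.)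
3. Parameter space. KP/BFNP/dCM use `P̄ = |L^{⊗k}| = ℙ(H⁰(X, L^{⊗k}))`; here `a` is a coefficient vector
   of a form `F_a` on the ambient `ℙⁿ`, a point of the cone `S_k` over `|𝒪_{ℙⁿ}(k)|`. The map
   `S_k ∖ I(X)_k → |R_k|`, `a ↦ [F_a|_X]`, onto the linear system `R_k = im(H⁰(ℙⁿ,𝒪(k)) → H⁰(X,L^{⊗k}))`
   is `ℂˣ`-scaling followed by the linear projection from `ℙ(I(X)_k)`, so locally on the source a
   product `B̄ × D`, `D` contractible, along which members, smooth members and `𝒳` are pulled back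
   (`X_{F_a}` depends only on `[F_a|_X]`): `𝒳_{(B̄×D)∩U} = 𝒳̄_{B̄∩Ū} × D`, and a class is non-zero
   upstairs iff downstairs (a slice is a left inverse). Non-vanishing over `B` is monotone in `B`
   (`familyClassMap_eq_zero_of_subset`), so product neighbourhoods suffice and the predicate at `a`
   is KP's at `[F_a|_X] ∈ |R_k|`. And `|R_k| = P̄` once `H⁰(ℙⁿ,𝒪(k)) → H⁰(X,𝒪_X(k))` is onto: for
   `k ≫ 0` (Serre, Hartshorne III Thm. 5.2) — the range of KP Conj. 41 / BFNP Def. 41, Cor. 46 / dCM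
   Prop. 3.7 ("`m ≫ 0`") — and for all `k ≥ 1` if `X ⊂ ℙⁿ` is projectively normal. Forms vanishing on
   `X` (e.g. `a = 0`) are not points of `P̄`; there the value is junk, and consumers quantify over
   `dualVarietyCone`, which excludes them (`zero_notMem_smoothLocus`, `zero_notMem_dualVarietyCone`).
4. Junk inputs: `d ≠ dim X`, `ζ` not primitive (then every point is "singular": the class survives
   fibrewise), `k = 0`. Torsion singularities `σ_{ℤ,p}` (KP Thm. 37) are invisible to the rational
   `sing_p` of KP Def. 38 / BFNP, as here.

## What is NOT here

* `ANF(U, ℋ)`, `J(ℋ)`, `AJ` (KP (3-5)), admissibility, the biextension heights of Brosnan–Pearlstein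
  (separate request `BiextensionHeightPackage`); KP Thm. 42 / BFNP Thm. 2.
* The theorems KP (3-7) (`sing_p(ν_ζ) ≠ 0 ⟹ ζ|_{X_p} ≠ 0`) and BFNP Prop. 43 + Cor. 46 = dCM Prop. 3.7
  (`⟺` for `k ≫ 0`): named facts of the companion file `NormalFunctionSingularityFacts`.

## References

* [KerrPearlstein2011] M. Kerr, G. Pearlstein, An exponential history of functions with logarithmic
  growth, MSRI Publ. 58 (2011): §3.2 p. 321 (`σ_{ℤ,p}`, `sing_p`, Rem. 36, Thm. 37, Def. 38, (3-4),
  (3-5)), §3.3 ((3-6), Lemma 40, Conj. 41, Thm. 42, (3-7)), §3.5 (Thm. 53, (3-11), (3-12), Rem. 55).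
* [BrosnanFangNiePearlstein2009] P. Brosnan, H. Fang, Z. Nie, G. Pearlstein, Singularities of admissible
  normal functions, Invent. Math. 177 (2009) [arXiv:0711.0964: (1.1), Conj. 1, Thm. 2, Lemma 5,
  Thm. 12, Rem. 27, Para 33–37, Prop. 35, Thm. 38, Lemma 39, Cor. 40, Def. 41, Prop. 43, Cor. 46].
* [DecataldoMigliorini2009] M. A. de Cataldo, L. Migliorini, On singularities of primitive cohomology
  classes, Proc. AMS 137 (2009) [arXiv:0711.1307: §2.1, (4)–(13), Lemma 3.1, (16)–(18), Def. 3.3,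
  Rem. 3.2, 3.4, Prop. 3.6, 3.7].
* [GreenGriffiths2007Singularities] M. Green, P. Griffiths, Algebraic cycles and singularities of normal
  functions (2007). [GortzWedhorn2020] (13.13). [Hartshorne1977] II.7, III Thm. 5.2.
-/

noncomputable section

open CategoryTheory AlgebraicGeometry Filter Topology
open Literature.AlgebraicTopology.SingularHomology
open Literature.AlgebraicGeometry.Resolution (Monomials formOfCoeffs isHomogeneous_formOfCoeffs)

namespace Literature.AlgebraicGeometry.HodgeTheory

section HodgeTheory

/-! ### Degree-`k` forms on `ℙⁿ` through their coefficient vectors -/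

/-- **The coefficient space of degree-`k` forms on `ℙⁿ`**, `a = (a_m)_{|m| = k}` indexed by the
monomials of degree `k` (tree `Resolution.Monomials`), with its topology of finite-dimensional complex
vector space: the affine cone over the complete linear system `|𝒪_{ℙⁿ}(k)| ≅ ℙ^{N}` (Hartshorne II
Prop. 5.13, II.7). The form with coefficient vector `a` is `Resolution.formOfCoeffs a = Σ a_m x^m`.
[folklore] -/
abbrev CoeffSpace (n k : ℕ) : Type :=
  Monomials (Fin (n + 1)) k → ℂ

/-- `F_0 = 0`: the zero coefficient vector gives the zero form. [folklore] -/
@[simp]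
theorem formOfCoeffs_zero {n k : ℕ} : formOfCoeffs (0 : CoeffSpace n k) = 0 := by
  simp [formOfCoeffs]

/-! ### Members of the linear system: zero sets, complex points, the section as a scheme -/

variable {X : Motives.SchemeOver ℂ} (e : Motives.ProjectiveEmbedding X)

/-- The scheme points of the **hypersurface section `X_F = X ∩ V₊(F)`**: the preimage under the
embedding `e : X ↪ ℙⁿ` of the projective zero locus `V₊(F)` (the spelling of route
`HeightMassDefect.SectionRestriction`; KP (3-6): `X_s = π⁻¹(s)`). [cite: KerrPearlstein2011, §3.3 (3-6)] -/
def memberSet (F : MvPolynomial (Fin (e.n + 1)) ℂ) : Set X.left :=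
  letI := MvPolynomial.gradedAlgebra (σ := Fin (e.n + 1)) (R := ℂ)
  e.ι.left.base ⁻¹'
    ProjectiveSpectrum.zeroLocus (MvPolynomial.homogeneousSubmodule (Fin (e.n + 1)) ℂ)
      ({F} : Set (MvPolynomial (Fin (e.n + 1)) ℂ))

/-- `memberSet e F` is literally the set `Z` of route `HeightMassDefect.SectionRestriction`
(`Z = e.ι.left.base ⁻¹' V₊(F)`), by `rfl`. [cite: KerrPearlstein2011, §3.3 (3-6)] -/
theorem memberSet_eq (F : MvPolynomial (Fin (e.n + 1)) ℂ) :
    memberSet e F = e.ι.left.base ⁻¹'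
      (letI := MvPolynomial.gradedAlgebra (σ := Fin (e.n + 1)) (R := ℂ)
       ProjectiveSpectrum.zeroLocus (MvPolynomial.homogeneousSubmodule (Fin (e.n + 1)) ℂ) {F}) :=
  rfl

/-- The zero form cuts out all of `X`. [folklore] -/
@[simp]
theorem memberSet_zero : memberSet e 0 = Set.univ := by
  letI := MvPolynomial.gradedAlgebra (σ := Fin (e.n + 1)) (R := ℂ)
  rw [memberSet, ProjectiveSpectrum.zeroLocus_singleton_zero]
  exact Set.eq_univ_of_forall fun _ ↦ Set.mem_univ _

/-- The complex points `X_F(ℂ) = {P ∈ X(ℂ) | P ∈ X_F}` of a hypersurface section, with the analytic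
(subspace) topology. [cite: KerrPearlstein2011, §3.3 (3-6)] -/
abbrev MemberPoints (F : MvPolynomial (Fin (e.n + 1)) ℂ) : Type :=
  {P : Motives.ComplexPoints X // P.pt ∈ memberSet e F}

/-- The restriction map `α_p : Hᵈ(X(ℂ); ℂ) ⟶ Hᵈ(X_F(ℂ); ℂ)` to a hypersurface section (the left
vertical arrow of KP (3-7)). [cite: KerrPearlstein2011, §3.3 (3-7)] -/
abbrev restrictToMember (F : MvPolynomial (Fin (e.n + 1)) ℂ) (d : ℕ) :
    complexBetti X d ⟶ singularCohomology ℂ ℂ (MemberPoints e F) d :=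
  singularCohomology.map ℂ ℂ
    (⟨Subtype.val, continuous_subtype_val⟩ : C(MemberPoints e F, Motives.ComplexPoints X)) d

/-- **The hypersurface section `X_F ⊆ X` as a closed subscheme**: the zero scheme (ideal sheaf) of
the section `F(s₀, …, sₙ) ∈ Γ(X, L^{⊗k})`, `sᵢ = e^*xᵢ`, `L = e^*𝒪(1)` — the schematic inverse image
`e⁻¹(V₊(F)) = X ∩ V₊(F)` (Görtz–Wedhorn (13.13): "`D_{i^*(H)} = i⁻¹(H)`"; tree
`Motives.GeneratingSections.Sec.zeroIdeal`, `secOfForm`). [cite: GortzWedhorn2020, Section (13.13) p. 505] -/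
def memberIdeal {k : ℕ} (F : MvPolynomial (Fin (e.n + 1)) ℂ) (hF : F.IsHomogeneous k) :
    X.left.IdealSheafData :=
  ((Motives.GeneratingSections.ofHom (k := ℂ) (ι := Fin (e.n + 1)) e.ι.left).secOfForm
    X.hom F hF).zeroIdeal

/-- **The cone over `U = P̄ ∖ X̂`, the smooth members**: coefficient vectors `a` whose form `F_a` does
not vanish identically on `X` (so that `[F_a|_X]` is a point of the linear system) and whose section
`X_{F_a} → Spec ℂ` is a smooth scheme (KP §3.3: `X̂` = "the points `s ∈ P̄` such that `X_s` is
singular", `P = P̄ - X̂`; BFNP Para 37: `π` is smooth over the complement of the dual variety).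
[cite: KerrPearlstein2011, §3.3] -/
def smoothLocus (k : ℕ) : Set (CoeffSpace e.n k) :=
  {a | memberSet e (formOfCoeffs a) ≠ Set.univ ∧
    Smooth ((memberIdeal e (formOfCoeffs a) (isHomogeneous_formOfCoeffs a)).subschemeι ≫ X.hom)}

/-- **The cone over the dual variety `X̂ ⊂ P̄`**: coefficient vectors of forms not vanishing on `X`
whose hypersurface section is singular. [cite: KerrPearlstein2011, §3.3] -/
def dualVarietyCone (k : ℕ) : Set (CoeffSpace e.n k) :=
  {a | memberSet e (formOfCoeffs a) ≠ Set.univ ∧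
    ¬ Smooth ((memberIdeal e (formOfCoeffs a) (isHomogeneous_formOfCoeffs a)).subschemeι ≫ X.hom)}

variable {e} in
/-- Unfolding of `smoothLocus`. [cite: KerrPearlstein2011, §3.3] -/
theorem mem_smoothLocus_iff {k : ℕ} (a : CoeffSpace e.n k) :
    a ∈ smoothLocus e k ↔ memberSet e (formOfCoeffs a) ≠ Set.univ ∧
      Smooth ((memberIdeal e (formOfCoeffs a) (isHomogeneous_formOfCoeffs a)).subschemeι ≫ X.hom) :=
  Iff.rfl

variable {e} in
/-- Unfolding of `dualVarietyCone`. [cite: KerrPearlstein2011, §3.3] -/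
theorem mem_dualVarietyCone_iff {k : ℕ} (a : CoeffSpace e.n k) :
    a ∈ dualVarietyCone e k ↔ memberSet e (formOfCoeffs a) ≠ Set.univ ∧
      ¬ Smooth ((memberIdeal e (formOfCoeffs a) (isHomogeneous_formOfCoeffs a)).subschemeι ≫ X.hom) :=
  Iff.rfl

/-- The dual variety cone and the smooth locus are disjoint. [cite: KerrPearlstein2011, §3.3] -/
theorem disjoint_dualVarietyCone_smoothLocus (k : ℕ) :
    Disjoint (dualVarietyCone e k) (smoothLocus e k) :=
  Set.disjoint_left.mpr fun _ ha hs ↦ ha.2 hs.2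

/-- Together they are exactly the forms not vanishing on `X` (the cone over `P̄`).
[cite: KerrPearlstein2011, §3.3] -/
theorem dualVarietyCone_union_smoothLocus (k : ℕ) :
    dualVarietyCone e k ∪ smoothLocus e k = {a | memberSet e (formOfCoeffs a) ≠ Set.univ} := by
  ext a
  simp only [Set.mem_union, mem_dualVarietyCone_iff, mem_smoothLocus_iff, Set.mem_setOf_eq]
  tauto

/-- The origin of the cone (the zero form, cutting out all of `X`) is not a smooth member …
[cite: KerrPearlstein2011, §3.3] -/
theorem zero_notMem_smoothLocus (k : ℕ) : (0 : CoeffSpace e.n k) ∉ smoothLocus e k := by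
  simp [mem_smoothLocus_iff]

/-- … nor a point of the dual variety cone: it is not a point of `P̄` at all.
[cite: KerrPearlstein2011, §3.3] -/
theorem zero_notMem_dualVarietyCone (k : ℕ) : (0 : CoeffSpace e.n k) ∉ dualVarietyCone e k := by
  simp [mem_dualVarietyCone_iff]

/-! ### The incidence variety over a subset of the parameter space -/

/-- **The incidence variety over `S`**: `𝒳_S = {(P, a) ∈ X(ℂ) × CoeffSpace | a ∈ S, P ∈ X_{F_a}}`
(KP (3-6); BFNP Para 37), as a subset of the product (subspace topology).
[cite: KerrPearlstein2011, §3.3 (3-6)] -/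
def familyOver (k : ℕ) (S : Set (CoeffSpace e.n k)) :
    Set (Motives.ComplexPoints X × CoeffSpace e.n k) :=
  {x | x.2 ∈ S ∧ x.1.pt ∈ memberSet e (formOfCoeffs x.2)}

variable {e} in
/-- Unfolding of `familyOver`. [cite: KerrPearlstein2011, §3.3 (3-6)] -/
theorem mem_familyOver_iff {k : ℕ} {S : Set (CoeffSpace e.n k)}
    (x : Motives.ComplexPoints X × CoeffSpace e.n k) :
    x ∈ familyOver e k S ↔ x.2 ∈ S ∧ x.1.pt ∈ memberSet e (formOfCoeffs x.2) :=
  Iff.rfl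

/-- `𝒳_S ⊆ 𝒳_{S'}` for `S ⊆ S'`. [cite: KerrPearlstein2011, §3.3 (3-6)] -/
theorem familyOver_mono (k : ℕ) {S S' : Set (CoeffSpace e.n k)} (h : S ⊆ S') :
    familyOver e k S ⊆ familyOver e k S' :=
  fun _ hx ↦ ⟨h hx.1, hx.2⟩

/-- The projection `pr₁ : 𝒳_S → X(ℂ)` (KP §3.3, `pr : 𝒳 → X`). [cite: KerrPearlstein2011, §3.3] -/
abbrev familyProj (k : ℕ) (S : Set (CoeffSpace e.n k)) :
    C(↥(familyOver e k S), Motives.ComplexPoints X) :=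
  ⟨fun x ↦ x.1.1, continuous_fst.comp continuous_subtype_val⟩

/-- The inclusion `𝒳_S ↪ 𝒳_{S'}` for `S ⊆ S'`. [cite: KerrPearlstein2011, §3.3 (3-6)] -/
abbrev familyIncl (k : ℕ) {S S' : Set (CoeffSpace e.n k)} (h : S ⊆ S') :
    C(↥(familyOver e k S), ↥(familyOver e k S')) :=
  ⟨fun x ↦ ⟨x.1, familyOver_mono e k h x.2⟩, by fun_prop⟩

/-- **`pr₁^* : Hᵈ(X(ℂ); ℂ) ⟶ Hᵈ(𝒳_S; ℂ)`**, the pull-back of classes of `X` to the incidence variety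
over `S` (KP §3.5: `pr^*(ζ̃)`; BFNP Cor. 46: `pr^*ζ`). [cite: KerrPearlstein2011, §3.5 (3-12)] -/
abbrev familyClassMap (k : ℕ) (S : Set (CoeffSpace e.n k)) (d : ℕ) :
    complexBetti X d ⟶ singularCohomology ℂ ℂ ↥(familyOver e k S) d :=
  singularCohomology.map ℂ ℂ (familyProj e k S) d

/-- `pr₁` on `𝒳_S` factors through `𝒳_{S'}`. [cite: KerrPearlstein2011, §3.3] -/
theorem familyProj_comp_familyIncl (k : ℕ) {S S' : Set (CoeffSpace e.n k)} (h : S ⊆ S') :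
    (familyProj e k S').comp (familyIncl e k h) = familyProj e k S :=
  rfl

/-- Restriction in stages: `Hᵈ(X) → Hᵈ(𝒳_S)` is `Hᵈ(X) → Hᵈ(𝒳_{S'}) → Hᵈ(𝒳_S)` for `S ⊆ S'`.
[cite: KerrPearlstein2011, §3.3] -/
theorem familyClassMap_eq_comp (k : ℕ) {S S' : Set (CoeffSpace e.n k)} (h : S ⊆ S') (d : ℕ) :
    familyClassMap e k S d =
      familyClassMap e k S' d ≫ singularCohomology.map ℂ ℂ (familyIncl e k h) d := by
  rw [familyClassMap, ← familyProj_comp_familyIncl e k h, singularCohomology.map_comp]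

/-- **Monotonicity**: a class dying over `S'` dies over every `S ⊆ S'`. [cite: KerrPearlstein2011, §3.3] -/
theorem familyClassMap_eq_zero_of_subset (k : ℕ) {S S' : Set (CoeffSpace e.n k)} (h : S ⊆ S')
    {d : ℕ} {ζ : complexBetti X d} (hζ : familyClassMap e k S' d ζ = 0) :
    familyClassMap e k S d ζ = 0 := by
  rw [familyClassMap_eq_comp e k h d, ModuleCat.comp_apply, hζ, map_zero]

/-! ### Primitive classes -/

/-- A class `ζ ∈ Hᵈ(X(ℂ); ℂ)` is **primitive for the degree-`k` hypersurface sections** if it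
restricts to zero on every smooth member `X_F`, `[F] ∈ U` ("primitive with respect to `π^{sm}`",
KP (3-4)ff; BFNP Para 33: `α|_{𝒳_p} = 0` for `p` over which `π` is smooth). For a Hodge class of the
middle degree `d = dim X` and `k ≥ 1` this is the usual primitivity `ζ ∪ c₁(L) = 0` (KP p. 322).
[cite: KerrPearlstein2011, §3.2–3.3 (p. 321–322)] -/
def IsPrimitiveFor (k : ℕ) {d : ℕ} (ζ : complexBetti X d) : Prop :=
  ∀ a ∈ smoothLocus e k, restrictToMember e (formOfCoeffs a) d ζ = 0

namespace IsPrimitiveFor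

variable {e} {k d : ℕ}

/-- `0` is primitive. [cite: KerrPearlstein2011, §3.3] -/
theorem zero : IsPrimitiveFor e k (0 : complexBetti X d) :=
  fun _ _ ↦ map_zero _

/-- Primitive classes form a subgroup … [cite: KerrPearlstein2011, §3.3] -/
theorem add {ζ ζ' : complexBetti X d} (h : IsPrimitiveFor e k ζ) (h' : IsPrimitiveFor e k ζ') :
    IsPrimitiveFor e k (ζ + ζ') :=
  fun a ha ↦ by rw [map_add, h a ha, h' a ha, add_zero]

/-- … indeed a subspace. [cite: KerrPearlstein2011, §3.3] -/
theorem smul {ζ : complexBetti X d} (h : IsPrimitiveFor e k ζ) (c : ℂ) :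
    IsPrimitiveFor e k (c • ζ) :=
  fun a ha ↦ by rw [map_smul, h a ha, smul_zero]

end IsPrimitiveFor

/-! ### The singularity of `ν_{ζ,k}` at a point -/

/-- **The admissible normal function `ν_{ζ,k}` of `ζ` is singular at the point `[F_a]`**, i.e.
`sing_{[F_a]}(ν_{ζ,k}) ≠ 0` in `(R¹j_*ℋ_ℚ)_{[F_a]}` (KP §3.2 p. 321 and Def. 38; BFNP (1.1)), in the
topological rendering of the module docstring ("Rendering" 1–3: `⟺ s(ζ)_{[F_a]} ≠ 0`, the local
Green–Griffiths invariant of de Cataldo–Migliorini, `= sing ⊗ ℚ` by BFNP Para 36): for every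
neighbourhood `B` of `a` in the coefficient space, the pull-back `pr₁^*ζ` is non-zero on the part
`𝒳_{B ∩ U}` of the incidence variety lying over the smooth members in `B`. Intended inputs (KP's
setting): `X` smooth projective of dimension `2m`, `d = 2m`, `k ≥ 1`, `ζ` a primitive rational Hodge
class of type `(m, m)`, `a ∈ dualVarietyCone e k`; elsewhere the value is junk (docstring, steps 3–4).
[cite: KerrPearlstein2011, §3.2 (p. 321) and Def. 38] [cite: DecataldoMigliorini2009, Def. 3.3 and (13), (16)–(18)]
[cite: BrosnanFangNiePearlstein2009, (1.1), Prop. 35, Para 36 and Cor. 40] -/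
def AdmissibleNormalFunctionSingularity (k : ℕ) {d : ℕ} (ζ : complexBetti X d)
    (a : CoeffSpace e.n k) : Prop :=
  ∀ B ∈ 𝓝 a, familyClassMap e k (B ∩ smoothLocus e k) d ζ ≠ 0

/-- **`ν_{ζ,k}` is singular on `P̄ = |L^{⊗k}|`**: it is singular at some point of the dual variety
(KP Def. 38 and the sentence after Lemma 40: "`ν_ζ` is singular on `P̄` if there exists a point
`p ∈ X̂` such that `sing_p(ν) ≠ 0`"; the predicate of KP Conjecture 41 / BFNP Conjecture 1).
[cite: KerrPearlstein2011, Def. 38 and §3.3 (after Lemma 40)] -/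
def IsSingularOn (k : ℕ) {d : ℕ} (ζ : complexBetti X d) : Prop :=
  ∃ a ∈ dualVarietyCone e k, AdmissibleNormalFunctionSingularity e k ζ a

variable {e}

/-- Unfolding of `AdmissibleNormalFunctionSingularity`. [cite: KerrPearlstein2011, §3.2 (p. 321)] -/
theorem admissibleNormalFunctionSingularity_iff {k d : ℕ} (ζ : complexBetti X d)
    (a : CoeffSpace e.n k) :
    AdmissibleNormalFunctionSingularity e k ζ a ↔
      ∀ B ∈ 𝓝 a, familyClassMap e k (B ∩ smoothLocus e k) d ζ ≠ 0 :=
  Iff.rfl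

/-- A germ condition: it suffices that inside every neighbourhood of `a` there is a (smaller)
neighbourhood over whose smooth members the class survives (monotonicity,
`familyClassMap_eq_zero_of_subset`). [cite: KerrPearlstein2011, §3.2 (p. 321)] -/
theorem admissibleNormalFunctionSingularity_of_forall_exists {k d : ℕ} {ζ : complexBetti X d}
    {a : CoeffSpace e.n k}
    (h : ∀ B ∈ 𝓝 a, ∃ B' ∈ 𝓝 a, B' ⊆ B ∧ familyClassMap e k (B' ∩ smoothLocus e k) d ζ ≠ 0) :
    AdmissibleNormalFunctionSingularity e k ζ a := by
  intro B hB hzero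
  obtain ⟨B', -, hB'B, hB'⟩ := h B hB
  exact hB' (familyClassMap_eq_zero_of_subset e k (Set.inter_subset_inter_left _ hB'B) hzero)

/-- **Balls suffice**: `ν_{ζ,k}` is singular at `[F_a]` iff `pr₁^*ζ` survives over the smooth members
of every ball around `a` (the colimit over a neighbourhood basis, KP p. 321).
[cite: KerrPearlstein2011, §3.2 (p. 321)] -/
theorem admissibleNormalFunctionSingularity_iff_ball {k d : ℕ} (ζ : complexBetti X d)
    (a : CoeffSpace e.n k) :
    AdmissibleNormalFunctionSingularity e k ζ a ↔
      ∀ ε : ℝ, 0 < ε → familyClassMap e k (Metric.ball a ε ∩ smoothLocus e k) d ζ ≠ 0 := by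
  refine ⟨fun h ε hε ↦ h _ (Metric.ball_mem_nhds a hε), fun h ↦ ?_⟩
  refine admissibleNormalFunctionSingularity_of_forall_exists fun B hB ↦ ?_
  obtain ⟨ε, hε, hεB⟩ := Metric.mem_nhds_iff.mp hB
  exact ⟨Metric.ball a ε, Metric.ball_mem_nhds a hε, hεB, h ε hε⟩

/-- If the class dies over the smooth members of SOME neighbourhood, `ν_{ζ,k}` is not singular there
(KP Remark 36 is the case of a neighbourhood inside `U`). [cite: KerrPearlstein2011, §3.2 Remark 36] -/
theorem not_admissibleNormalFunctionSingularity_of_eq_zero {k d : ℕ} {ζ : complexBetti X d}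
    {a : CoeffSpace e.n k} {B : Set (CoeffSpace e.n k)} (hB : B ∈ 𝓝 a)
    (h0 : familyClassMap e k (B ∩ smoothLocus e k) d ζ = 0) :
    ¬ AdmissibleNormalFunctionSingularity e k ζ a :=
  fun h ↦ h B hB h0

namespace AdmissibleNormalFunctionSingularity

variable {k d : ℕ} {a : CoeffSpace e.n k}

/-- **The zero class is nowhere singular** (`sing_p` is a homomorphism; KP Lemma 40ff).
[cite: KerrPearlstein2011, §3.3 (after Lemma 40)] -/
theorem not_zero : ¬ AdmissibleNormalFunctionSingularity e k (0 : complexBetti X d) a :=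
  not_admissibleNormalFunctionSingularity_of_eq_zero Filter.univ_mem (map_zero _)

/-- A class with a singularity is non-zero. [cite: KerrPearlstein2011, §3.3 (after Lemma 40)] -/
theorem ne_zero {ζ : complexBetti X d} (h : AdmissibleNormalFunctionSingularity e k ζ a) : ζ ≠ 0 := by
  rintro rfl
  exact not_zero h

/-- **Additivity of `sing_p`**: a singularity of `ζ + ζ'` at `[F_a]` is a singularity of `ζ` or of
`ζ'` there. [cite: KerrPearlstein2011, §3.3 (after Lemma 40)] -/
theorem add {ζ ζ' : complexBetti X d} (h : AdmissibleNormalFunctionSingularity e k (ζ + ζ') a) :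
    AdmissibleNormalFunctionSingularity e k ζ a ∨ AdmissibleNormalFunctionSingularity e k ζ' a := by
  by_contra hcon
  simp only [not_or, admissibleNormalFunctionSingularity_iff, not_forall, not_not] at hcon
  obtain ⟨⟨B, hB, hBζ⟩, ⟨B', hB', hB'ζ'⟩⟩ := hcon
  refine h (B ∩ B') (Filter.inter_mem hB hB') ?_
  rw [map_add,
    familyClassMap_eq_zero_of_subset e k
      (Set.inter_subset_inter_left _ Set.inter_subset_left) hBζ,
    familyClassMap_eq_zero_of_subset e k
      (Set.inter_subset_inter_left _ Set.inter_subset_right) hB'ζ', add_zero]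

/-- `sing_p` is `ℂ`-linear: non-zero multiples have the same singularities.
[cite: KerrPearlstein2011, §3.3 (after Lemma 40)] -/
theorem smul_iff {ζ : complexBetti X d} {c : ℂ} (hc : c ≠ 0) :
    AdmissibleNormalFunctionSingularity e k (c • ζ) a ↔
      AdmissibleNormalFunctionSingularity e k ζ a := by
  simp only [admissibleNormalFunctionSingularity_iff, map_smul, ne_eq, smul_eq_zero, hc, false_or]

/-- In particular `-ζ` and `ζ` have the same singularities. [cite: KerrPearlstein2011, §3.3 (after Lemma 40)] -/
theorem neg_iff {ζ : complexBetti X d} :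
    AdmissibleNormalFunctionSingularity e k (-ζ) a ↔ AdmissibleNormalFunctionSingularity e k ζ a := by
  rw [← neg_one_smul ℂ ζ, smul_iff (neg_ne_zero.mpr one_ne_zero)]

end AdmissibleNormalFunctionSingularity

/-- The zero class is not singular on `P̄`. [cite: KerrPearlstein2011, Def. 38] -/
theorem not_isSingularOn_zero {k d : ℕ} : ¬ IsSingularOn e k (0 : complexBetti X d) :=
  fun ⟨_, _, h⟩ ↦ AdmissibleNormalFunctionSingularity.not_zero h

end HodgeTheory

end Literature.AlgebraicGeometry.HodgeTheory

end
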